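import Summits.Ventures.CertifiedManyBodySolver.Downfold.EmeryBoxesHg1201P10CGWSICThermalCapRetiltMarkovBoxp1
import Summits.Ventures.CertifiedManyBodySolver.Downfold.EmeryBoxesHg1201P10CGWSICThermalFloorAtlasWord
import Summits.Ventures.CertifiedManyBodySolver.Downfold.EmeryThermalAtomicFloor
import HarnessLib

/-!
# HIGH-TEMPERATURE-CLOSING `T > 0` WINDOW on HgBa2CuO4 (M19) @10 GPa U-SLICE «cGW-SIC» (8.837, 5.311) — `emeryBoxHg1201P10CGWSIC` (router/EMERY-FLOOR-ORDERS row 14): the ATOMIC-LIMIT floor (full entropy) ∨ the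
# family floor, against the re-tilted cap — both sides meet at `6 log 2` as β → 0

Venture CertifiedManyBodySolver, cell `pub/hubbard-downfold` (S1 = ROUTER) × crew hubbard-fast S2 (ii) × (iv) «T > 0 × multi-band» (D-0096 (ii)); seat hubbard-downfold-mod-4
(S1/S2 Emery seam, g17). Namespace `Summit.Ventures.CertifiedManyBodySolver.Downfold`. DOOR: `EmeryThermalAtomicFloor` (`holdsOn_emeryCellPressureAtomicFloor`: Peierls on the
whole occupation basis of the `Cu₄O₈` block, site-wise factorisation; the one-site function is the tree's `atomicPartitionFnReal β U μ`). INPUTS BY NAME: the family floor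
`emeryBoxHg1201P10CGWSIC_pressureFloorFam_m21o2` (`EmeryBoxesHg1201P10CGWSICThermalFloorAtlasWord`; C = (-169.458646, -169.651485)), the cap `emeryBoxHg1201P10CGWSIC_pressureCap_m21o2_retilt` (`EmeryBoxesHg1201P10CGWSICThermalCapRetiltMarkovBoxp1`; `6 log 2 + 48.2238·β`; flat word 51.0238).
ATOMIC DATA: Cu at `μ_d = −(εp + Δ_hi) = 483/50`, `U_d,hi = 8837/1000`; O at `μ_p = −εp = 21/2`, `U_p,hi = 5311/1000` ⇒ classical slope 41.8610·β (family slope 42.4129; cap 48.2238).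
RESULT: **`emeryBoxHg1201P10CGWSIC_pressureWindowHighT_m21o2`**: `max(atomic, family) ≤ P_cell ≤ 6 log 2 + 48.2238·β` on the whole box, every β ≥ 0; width → 0 as β → 0 (both sides `6 log 2`,
`emeryBoxHg1201P10CGWSIC_pressure_beta_zero_m21o2`); crossover β* ≈ 0.953 (T* ≈ 12182 K) below which the atomic floor is the better floor [float].

Everything PROVED (0 sorry); no definition. HONEST FRAMING: CERTIFIED inequalities on a SCREENING/EXTRAPOLATED-grade object; the atomic floor ignores hopping (its slope sits
0.5519 below the family floor's), so at physical temperatures (β ≈ 20–40 eV⁻¹) the family floor still decides and thermal scales are NOT resolved there; what is new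
is the correct INFINITE-TEMPERATURE closure of the window and a certified high-T regime (β ≲ β*) with width `≈ 6.3628·β`; grand-canonical at the stated level; no phase word;
no router number moves. WHAT-THIS-IS-NOT: a new certificate (pure algebra on landed objects; zero kit).
-/

noncomputable section

namespace Summit.Ventures.CertifiedManyBodySolver.Downfold

open NonemptyInterval Matrix Finset Literature.Probability.LatticeModels
open Literature.MathematicalPhysics.QuantumLattice Literature.Computation.Certificates
open Summit.Ventures.CertifiedManyBodySolver.Certificates OccupationCode ClusterLowerBound
open scoped BigOperators ComplexOrder

/-! ## §1 The atomic-limit floor on the box at εp = -21/2 -/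

/-- **ATOMIC-LIMIT `T > 0` FLOOR** on the whole `emeryBoxHg1201P10CGWSIC`, cuprate signs, level εp = -21/2 (chemical potential 21/2 eV), EVERY β ≥ 0:
`log z₀(β; U_d = 8837/1000, μ_d = 483/50) + 2·log z₀(β; U_p = 5311/1000, μ_p = 21/2) ≤ P_cell` with `z₀(β; U, μ) = 1 + 2e^{βμ} + e^{−β(U−2μ)}` (`atomicPartitionFnReal`; Cu at the
box's upper level `εp + Δ_hi = -483/50` and `U_d,hi`, O at `εp` and `U_p,hi`). Value `6 log 2` at β = 0; slope `41.8610·β` as β → ∞ (classical minimum, no hopping).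
[cite: Ruelle1969, §2.5–2.6] [cite: Ueltschi1999, §3] -/
theorem emeryBoxHg1201P10CGWSIC_pressureAtomicFloor_m21o2 {β : ℝ} (hβ : 0 ≤ β) :
    HoldsOn (fun p : EmeryCoord → ℝ => Real.log (atomicPartitionFnReal β (8837/1000 : ℝ) (483/50 : ℝ)) + 2 * Real.log (atomicPartitionFnReal β (5311/1000 : ℝ) (21/2 : ℝ)) ≤ emeryCellPressure β (emeryLine cuprateSigns (emeryLineCoords (((-21/2 : ℚ)) : ℝ) p))) emeryBoxHg1201P10CGWSIC := by
  intro p hp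
  have h := holdsOn_emeryCellPressureAtomicFloor (E := emeryBoxHg1201P10CGWSIC) (eA := hg1201P10Emery_tpd) (eB := hg1201P10Emery_tpp) (eD := hg1201P10CGWSICEmery_Delta) (eUd := hg1201P10CGWSICEmery_Udd) (eUp := hg1201P10CGWSICEmery_Upp) (-21/2) (by simp [emeryBoxHg1201P10CGWSIC, emeryBoxHg1201P10CGWSICSrc, Function.update]) (by simp [emeryBoxHg1201P10CGWSIC, emeryBoxHg1201P10CGWSICSrc, Function.update]) (Function.update_self _ _ _) (by simp [emeryBoxHg1201P10CGWSIC, emeryBoxHg1201P10CGWSICSrc, Function.update]) (by simp [emeryBoxHg1201P10CGWSIC, emeryBoxHg1201P10CGWSICSrc, Function.update]) cuprateSigns hβ p hp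
  simp only [hg1201P10CGWSICEmery_Delta, hg1201P10CGWSICEmery_Udd, hg1201P10CGWSICEmery_Upp, Entry.encl_ofEnds_snd] at h
  push_cast at h
  norm_num at h ⊢
  exact h

/-! ## §2 The best floor and the HIGH-TEMPERATURE-CLOSING window -/

/-- **BEST `T > 0` FLOOR = max(atomic, family)** on the whole box at εp = -21/2, every β ≥ 0: the atomic floor (full entropy, slope 41.8610) wins for
β < β* ≈ 0.953 (T > 12182 K), the family floor `emeryBoxHg1201P10CGWSIC_pressureFloorFam_m21o2` (slope 42.4129, entropy ¼·log 2) for β > β*. [cite: Ruelle1969, §2.5–2.6] [cite: Israel1979, Lemma II.3.1] -/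
theorem emeryBoxHg1201P10CGWSIC_pressureFloorBest_m21o2 {β : ℝ} (hβ : 0 ≤ β) :
    HoldsOn (fun p : EmeryCoord → ℝ => max (Real.log (atomicPartitionFnReal β (8837/1000 : ℝ) (483/50 : ℝ)) + 2 * Real.log (atomicPartitionFnReal β (5311/1000 : ℝ) (21/2 : ℝ))) (Real.log (Real.exp (-(β * (-84729323/500000 : ℝ))) + Real.exp (-(β * (-33930297/200000 : ℝ)))) / 4) ≤ emeryCellPressure β (emeryLine cuprateSigns (emeryLineCoords (((-21/2 : ℚ)) : ℝ) p))) emeryBoxHg1201P10CGWSIC :=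
  fun p hp => max_le (emeryBoxHg1201P10CGWSIC_pressureAtomicFloor_m21o2 hβ p hp) (emeryBoxHg1201P10CGWSIC_pressureFloorFam_m21o2 hβ p hp)

/-- **THE HIGH-TEMPERATURE-CLOSING TWO-SIDED `T > 0` WINDOW** (hypothesis-free on both sides) on the whole `emeryBoxHg1201P10CGWSIC`, level εp = -21/2, EVERY β ≥ 0:
`max(atomic, family) ≤ P_cell ≤ 6 log 2 + β·7715813/160000` (cap = `emeryBoxHg1201P10CGWSIC_pressureCap_m21o2_retilt`, hubbard-box-p1 re-tilted). BOTH SIDES EQUAL `6 log 2` AT β = 0; the width is `O(β)` for small β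
(slope gap 6.3628 against the atomic floor, 5.8110 against the family floor). Table [float; `T = 11604.5/β` K]:
| β (1/eV) | T (K) | atomic floor | family floor | best floor | cap | width |
|---|---|---|---|---|---|---|
| 0.01 | 1160450 | 4.4210 | 0.5972 | 4.4210 | 4.6411 | 0.2202 |
| 0.1 | 116045 | 7.0967 | 4.4122 | 7.0967 | 8.9813 | 1.8846 |
| 0.5 | 23209 | 22.0557 | 21.3680 | 22.0557 | 28.2708 | 6.2151 |
| 1 | 11604 | 42.5135 | 42.5632 | 42.5632 | 52.3827 | 9.8195 |
| 2 | 5802 | 84.0483 | 84.9554 | 84.9554 | 100.6065 | 15.6511 |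
| 5 | 2321 | 209.3371 | 212.1451 | 212.1451 | 245.2780 | 33.1329 |
| 10 | 1160 | 418.6105 | 424.1626 | 424.1626 | 486.3972 | 62.2345 |
| 20 | 580 | 837.2200 | 848.2627 | 848.2627 | 968.6355 | 120.3729 |
| 40 | 290 | 1674.4400 | 1696.5150 | 1696.5150 | 1933.1121 | 236.5972 |
[cite: Israel1979, Thm. I.2.4] [cite: Ruelle1969, §2.5–2.6] [cite: Ueltschi1999, §3] -/
theorem emeryBoxHg1201P10CGWSIC_pressureWindowHighT_m21o2 {β : ℝ} (hβ : 0 ≤ β) :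
    HoldsOn (fun p : EmeryCoord → ℝ =>
      max (Real.log (atomicPartitionFnReal β (8837/1000 : ℝ) (483/50 : ℝ)) + 2 * Real.log (atomicPartitionFnReal β (5311/1000 : ℝ) (21/2 : ℝ))) (Real.log (Real.exp (-(β * (-84729323/500000 : ℝ))) + Real.exp (-(β * (-33930297/200000 : ℝ)))) / 4) ≤ emeryCellPressure β (emeryLine cuprateSigns (emeryLineCoords (((-21/2 : ℚ)) : ℝ) p)) ∧
      emeryCellPressure β (emeryLine cuprateSigns (emeryLineCoords (((-21/2 : ℚ)) : ℝ) p)) ≤ 6 * Real.log 2 + β * (7715813/160000 : ℝ)) emeryBoxHg1201P10CGWSIC :=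
  fun p hp => ⟨emeryBoxHg1201P10CGWSIC_pressureFloorBest_m21o2 hβ p hp, by simpa using emeryBoxHg1201P10CGWSIC_pressureCap_m21o2_retilt hβ p hp⟩

/-- **At β = 0 the window is a point**: `P_cell(0, ·) = 6 log 2` on the whole box (floor and cap coincide). [cite: Ueltschi1999, §3] -/
theorem emeryBoxHg1201P10CGWSIC_pressure_beta_zero_m21o2 :
    HoldsOn (fun p : EmeryCoord → ℝ => emeryCellPressure 0 (emeryLine cuprateSigns (emeryLineCoords (((-21/2 : ℚ)) : ℝ) p)) = 6 * Real.log 2) emeryBoxHg1201P10CGWSIC := by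
  intro p hp
  have h := emeryBoxHg1201P10CGWSIC_pressureWindowHighT_m21o2 le_rfl p hp
  rw [atomicPartitionFnReal_beta_zero, atomicPartitionFnReal_beta_zero, show (4 : ℝ) = 2 ^ 2 by norm_num, Real.log_pow] at h
  simp only [Nat.cast_ofNat, zero_mul, add_zero] at h
  have h1 := (le_max_left _ _).trans h.1
  linarith [h.2]

end Summit.Ventures.CertifiedManyBodySolver.Downfold

end
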